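import Literature.MathematicalPhysics.QuantumFieldTheory.BorinskyMunchTellander2023.GraphLaplacian
import Literature.MathematicalPhysics.QuantumFieldTheory.BorinskyMunchTellander2023.KinematicRegimes
import Literature.MathematicalPhysics.QuantumFieldTheory.Volkov2016.CircuitResistanceKirchhoff
import HarnessLib

/-!
# Borinsky–Munch–Tellander 2023 §2.1 eq. (laplaceUF), SECOND identity — `ℱ(x) = 𝒰(x)·(−Σ_{u,v∈V∖{v_0}} 𝒫^{u,v} 𝓛⁻¹(x)_{u,v} + Σ_e m_e² x_e)` — and Borinsky 2020 §7.1 eq. (PsiPhi_fast), SECOND identity — `Φ_G = Ψ_G·(Tr(Pᵀ L̃⁻¹ P) + Σ_e x_e m_e²)` — AS PRINTED, PROVED; with the first cofactors of the grounded Laplacian as separating-2-forest sums (the all-minors matrix-tree theorem in the case these identities use) over every commutative ring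

independent recomputation; certified where stated, statistical where stated; no new-physics claim.

CITATION HEADER (venture `QEDPrecision`, cell `pub-qed`, track TROPICAL, LIT seat `pub-qed-trop-lit` gen 33; VALUE-FREE: identities
between polynomials / rational functions attached to an ARBITRARY edge list, an arbitrary kinematic matrix `𝒫` and arbitrary masses;
no word, no integral, no Monte-Carlo value, nothing of any Set V family). Companion of `GraphLaplacian.lean` (same seat, gen 32:
BMT23's `𝓛(x) = ℰᵀ diag(1/x) ℰ`, (eq:laplaceUF)'s FIRST identity `𝒰 = det 𝓛 · Π x_e`, `𝓛(x) ≻ 0`; its header lists "NOT typed: the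
SECOND identity of (eq:laplaceUF) (`ℱ` through `𝓛⁻¹` — the all-minors matrix-tree theorem for two-forests …)"), of
`KinematicRegimes.lean` (BMT23's `ℱ` from the Gram matrix `𝒫`, `gramSecondSymanzik`; `rootSide`, `sqMomentum`, `allMinusGram`), of
`Borinsky2020/SecondSymanzikPermutahedron.lean` (`secondSymanzikPolynomial` = eq. (PsiPhi_slow), `IsSpanningTwoForest`,
`momentumFlow`) and of the V3a seat's `Volkov2016/CircuitResistanceKirchhoff.lean` (gen 37, same day: the conductance Laplacian
`ℰᵀ diag(g) ℰ`, the auxiliary line `withLine`/`auxRow`, and **`auxRow_dotProduct_adjugate_laplacian`**: `uᵀ adj(L) u = τ₂(g; a|b)`, the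
separating-2-tree sum, for the incidence row `u` of ANY line `ab` — the one combinatorial input of this file). This file closes the
print-only item both charge sources share: the EVALUATION FORMULA for the second Symanzik polynomial that the tropical samplers
(`feyntrop` §4.2 steps 1–2, 8–9; Borinsky §7.1 "With a Cholesky decomposition of the matrix L̃(x) both the value of Ψ_G(x) and
Φ_G(x) can be immediately calculated") actually run, as an identity with the combinatorial two-forest polynomial of eq. (polyUF) /
(PsiPhi_slow) that the tree's Newton-polytope theorems (Theorem 32 / 3.5 / 3.6 / 3.9) are about.

SOURCES, VERBATIM. [BorinskyMunchTellander2023] M. Borinsky, H. J. Munch, F. Tellander, *Tropical Feynman integration in the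
Minkowski regime*, Comput. Phys. Commun. 292 (2023) 108874 = arXiv:2302.08955v2 (HOME `data/lit/sources/.cache/2302.08955/main.tex`),
§2.1 (l.291–300): "We use 𝒱(x) = ℱ(x)/𝒰(x) as a shorthand for the quotient of the two Symanzik polynomials that can be defined using
the reduced graph Laplacian 𝓛(x), a (|V|−1)×(|V|−1) matrix given element-wise by 𝓛(x)_{u,v} = Σ_{e∈E} ℰ_{u,e}ℰ_{v,e}/x_e for all
u,v ∈ V∖{v_0}. We have the identities (eq:laplaceUF) 𝒰(x) = det 𝓛(x) (Π_{e∈E} x_e), ℱ(x) = 𝒰(x)·(−Σ_{u,v∈V∖{v_0}} 𝒫^{u,v}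
𝓛⁻¹(x)_{u,v} + Σ_{e∈E} m_e² x_e), where 𝒫^{u,v} = p_u·p_v with the scalar product being computed using the Minkowski metric."
(l.302–305) "(eq:polyUF) 𝒰(x) = Σ_T Π_{e∉T} x_e, ℱ(x) = −Σ_F p(F)² Π_{e∉F} x_e + 𝒰(x) Σ_{e∈E} m_e² x_e, where we sum over all
spanning trees T and all spanning two-forests F of G, and p(F)² is the Minkowski squared momentum running between the two-forest
components." §2.2 (l.329–332): "a symmetric |V|×|V| matrix 𝒫 with vanishing row and column sums (i.e. the momentum conservation
conditions …)"; (l.338–341) "𝒫^{u,v} = −p̃_uᵀ p̃_v". §4.2 (l.1049–1053): "Surprisingly, the explicit polynomial expression for 𝒰 and ℱ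
from eq. (polyUF) are harder to evaluate than the matrix and determinant expression (laplaceUF) … Standard linear algebra algorithms
as the Cholesky or LU decompositions provide polynomial time algorithms to compute the inverse and determinant of 𝓛(x) and therefore
values of 𝒰(x) and ℱ(x) (see, e.g., [Borinsky 2020, Sec. 7.1])"; (l.1066) "where we agree that 𝓛⁻¹(x)_{u,v} = ℳ(x)_{u,v} = 0 if any of u
or v is equal to v_0"; steps (l.1079–1099) "1. Compute the graph Laplacian 𝓛(x) … 2. Compute the inverse 𝓛⁻¹(x) (e.g. by Cholesky
decomposing 𝓛(x)). … 9. Use the formulas (laplaceUF) to obtain values for 𝒰(X), ℱ(X) and 𝒱(X) = ℱ(X)/𝒰(X)."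
[Borinsky2020] M. Borinsky, *Tropical Monte Carlo quadrature for Feynman integrals*, AIHPD 10 (2023) 635–685 = arXiv:2008.12310v2
(HOME `data/lit/sources/.cache/2008.12310/tropical.tex`), §7.1 (l.1186–1191): "(PsiPhi_slow) Ψ_G(x) = Σ_{T_1} Π_{e∉T_1} x_e,
Φ_G(x) = Σ_{T_2} ‖p(T_2)‖² Π_{e∉T_2} x_e + Ψ_G Σ_e x_e m_e², where p(T_2) is the total momentum flowing between the two components of
the 2-forest T_2. … These polynomials can also be written in terms of the weighted V×V Laplace matrix of the graph (see for instance
[Bogner–Weinzierl 2010]) … This matrix is only positive semi-definite whereas the reduced Laplacian L̃_{v,w}(x), which is given by an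
arbitrary leading principle minor of the matrix L_{v,w}(x), is positive definite. The Symanzik polynomials can be written as
(PsiPhi_fast) Ψ_G(x) = (Π_e x_e) det(L̃), Φ_G(x) = Ψ_G (Tr(Pᵀ L̃⁻¹ P) + Σ_e x_e m_e²), where P is the (V−1)×D matrix, given row-wise
by the incoming momenta, p^{(v)} ∈ ℝ^D: P_{v,μ} = p^{(v)}_μ where v = 1,…,V−1 and μ is a D-dimensional spacetime index. Note that due
to momentum conservation no information is lost when only V−1 of the V incoming momenta are used." (l.1193) "With a Cholesky
decomposition of the matrix L̃(x) both the value of Ψ_G(x) and Φ_G(x) can be immediately calculated."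
[BognerWeinzierl2010] C. Bogner, S. Weinzierl, *Feynman graph polynomials*, Int. J. Mod. Phys. A 25 (2010) 2585–2618 = arXiv:1002.3458
(held `paper:arxiv-1002.3458`, chunks p0011–p0012), §3 "The matrix-tree theorem" (p0011:L1–L34): "The all-minors matrix-tree theorem
relates the determinant of the corresponding minor to a specific sum over spanning forests [Chaiken 1982, Chen 1982, Moon 1994]. …
We denote by 𝒯_k^{I,J} the spanning k-forests, such that each tree of an element of 𝒯_k^{I,J} contains exactly one vertex v_{i_α} and
exactly one vertex v_{j_β}. … The all-minors matrix-tree theorem reads then L[I,J] = (−1)^{|I|+|J|} Σ_{F∈𝒯_k^{I,J}} sgn(π_F)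
Π_{e_j∈F} x_j." and (p0011:L57–p0012:L33) the derivation of "ℱ_0 = x_1⋯x_n Σ_{(j,k)} (p_j·p_k/μ²) 𝒲^{(2)}_{(j,k)}(1/x_1,…,1/x_n)"
from it ("The remaining two are connected to a spanning 2-forest of the graph G, one to each tree of the 2-forest").

WHAT IS TYPED (all PROVED; 0 named facts, 0 `sorry`, no new definition; edge list `E : Fin N → Fin (V+1) × Fin (V+1)`, root `v_0 = 0`,
non-root vertices `u = i+1`, `v = k+1` for `i k : Fin V` — this IS BMT23's index set `V∖{v_0}` of (eq:laplaceUF) and Borinsky's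
`v = 1,…,V−1` of (PsiPhi_fast)).
Part 1 (any commutative ring `R`, conductances `g`, the V3a Laplacian `L(g) = ℰᵀ diag(g) ℰ`):
* `isTwoTree_iff_isSpanningTwoForest` (V3a's «2-дерево» = the tropical seat's spanning 2-forest, both rank forms);
  `auxRow_succ_zero` / `auxRow_succ_succ` (the rows of the lines `(i+1, 0)` and `(i+1, k+1)` are `e_i` and `e_i − e_k`);
  `isSymm_conductanceLaplacian`;
* `adjugate_laplacian_apply_self` — `adj(L)_{ii} = τ₂(g; i+1 | 0)`; `two_mul_adjugate_laplacian_apply` — POLARISATION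
  `2·adj(L)_{ik} = τ₂(i+1|0) + τ₂(k+1|0) − τ₂(i+1|k+1)`; `sepTwoTreeSum_eq_sum_ite`; `two_mul_adjugate_laplacian_eq`;
* **`adjugate_laplacian_apply`** — `adj(ℰᵀ diag(g) ℰ)_{ik} = Σ_{F} Π_{e∈F} g_e` over the spanning 2-forests `F` whose root tree contains
  NEITHER `i+1` NOR `k+1` (= Bogner–Weinzierl's `𝒯_2^{(v_0,u),(v_0,v)}`, sign `+`), for EVERY commutative ring `R` (proved in `ℤ[g_e]`,
  where `2` is cancellable, and transported along `ℤ[g] → R`).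
Part 2 (a field `K`; BMT23's `𝓛(x)` of `GraphLaplacian.lean`):
* `laplacian_eq_conductanceLaplacian` (`𝓛(x) = L(1/x)`); `prod_mul_adjugate_laplacian_apply`;
* **`kirchhoffEval_mul_inv_laplacian_apply`** — `𝒰(x)·𝓛⁻¹(x)_{ik} = Σ_{F : i+1, k+1 off the root tree} Π_{e∉F} x_e` for `x_e ≠ 0`,
  `det 𝓛(x) ≠ 0` (ANY field — so also at complex deformed points `X`, §4.2 steps 7–9);
* **`kirchhoffEval_mul_sum_mul_inv_laplacian`** — `𝒰·Σ_{u,v} Q^{u,v} 𝓛⁻¹_{u,v} = Σ_F Q(F)·Π_{e∉F} x_e`, `Q(F) = Σ_{u,v off the root tree} Q^{u,v}`,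
  for ANY array `Q` (no symmetry, no conservation);
* `sqMomentum_rootSide_eq_sum_succ` — under momentum conservation `p(F)²` read off `𝒫` on the root side = on the non-root side, which
  only involves `V∖{v_0}`;
* **`eval_gramSecondSymanzik_eq_laplaceUF`** — (eq:laplaceUF).2 AS PRINTED: for symmetric `𝒫` with vanishing row sums, real masses,
  real `x` with `x_e ≠ 0`, `det 𝓛(x) ≠ 0`: `ℱ(x) = 𝒰(x)·(−Σ_{i,k} 𝒫^{i+1,k+1} 𝓛⁻¹(x)_{ik} + Σ_e m_e² x_e)` for `ℱ = gramSecondSymanzik E 𝒫 m`;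
  `…_of_pos` (positive `x`, connected edge list: `det 𝓛 > 0` by `GraphLaplacian.det_laplacian_pos`);
  `eval_gramSecondSymanzik_div_kirchhoffEval` (`𝒱 = ℱ/𝒰 = −Σ 𝒫 𝓛⁻¹ + Σ m² x`, the quantity of §2.3/§4.2);
* **`eval_secondSymanzikPolynomial_eq_laplaceUF`** — Borinsky's (PsiPhi_fast).2 for Euclidean vector momenta in a real inner-product
  space under `Σ_v p^{(v)} = 0`: `Φ_G(x) = Ψ_G(x)·(Σ_{i,k} ⟨p^{(i+1)}, p^{(k+1)}⟩ L̃⁻¹_{ik} + Σ_e m_e² x_e)` (= BMT23 at `𝒫 = −(⟨p̃_u,p̃_v⟩)`,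
  `KinematicRegimes.gramSecondSymanzik_allMinusGram`); `…_of_pos`; and LITERALLY with the trace, `trace_transpose_mul_mul` +
  **`eval_secondSymanzikPolynomial_eq_trace`**: `Φ_G(x) = Ψ_G(x)·(Tr(Pᵀ L̃⁻¹ P) + Σ_e x_e m_e²)` for `p^{(v)} ∈ ℝ^D = EuclideanSpace ℝ ι`,
  `P_{v,μ} = p^{(v+1)}_μ`.

PROOF ROUTE (disclosed; not the all-minors theorem's sign bookkeeping). For the incidence row `u` of a line `ab`, V3a's
`auxRow_dotProduct_adjugate_laplacian` gives `uᵀ adj(L) u = τ₂(g; a|b)` (Cauchy's `det(L + uuᵀ) = det L + uᵀ adj(L) u` against the tree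
sum of the edge list with the line `ab` adjoined — Kirchhoff's own argument). The rows of the lines `(i+1, 0)`, `(k+1, 0)`, `(i+1, k+1)`
are `e_i`, `e_k`, `e_i − e_k`, so by symmetry of `adj(L)` polarisation yields `2·adj(L)_{ik} = τ₂(i+1|0) + τ₂(k+1|0) − τ₂(i+1|k+1)`; in a
spanning 2-forest (exactly two trees, `IsSpanningTwoForest.reachable_iff_not_reachable`) the indicator identity `[i+1∤0] + [k+1∤0] −
[i+1∤k+1] = 2·[i+1∤0 ∧ k+1∤0]` holds forest by forest; the factor `2` is cancelled in `ℤ[g_e]` and the identity transported to any ring by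
`RingHom.map_adjugate`. Part 2 is bookkeeping: `𝓛⁻¹ = det⁻¹·adj` (`Matrix.inv_def`), `𝒰 = det 𝓛 · Π x` (companion), `Π x · Π_{e∈F} x⁻¹ =
Π_{e∉F} x`, the swap `Σ_{u,v} Σ_F = Σ_F Σ_{u,v}`, and `p(F)²` moved to the non-root tree by `KinematicRegimes.sqMomentum_compl`.

NOT typed: (eq:AB)/(eq:diffV) (the `𝒱`-derivatives through `ℳ = 𝓛⁻¹𝒫𝓛⁻¹`); the complexity sentences ("harder to evaluate",
"nearly linear runtime", Cholesky cost); the general all-minors matrix-tree theorem (arbitrary `I`, `J`, signs `sgn π_F`) and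
Bogner–Weinzierl's `𝒲^{(2)}` route through the graph `G̃` with external vertices; the `ε`/deformation context of §2.3 (typed in
`ContourDeformation.lean` for an abstract `𝒱`). presearch (g33, 2026-08-25): `lit search --hybrid` «second Symanzik reduced Laplacian
inverse two-forests all minors matrix tree theorem» → held books van Mieghem 2010 pp.130–131, Biggs 1974 p.34, Gross–Saccoman–Suffel
2013 (Laplacian cofactors / spanning trees; none states the two-forest form used here); `lit search` → Bogner–Weinzierl 2010
arXiv:1002.3458 (OA, read: §3 as quoted — the printed source Borinsky cites); `lit galaxy search "all minors matrix tree|two-forest|…"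
--star all` → no usable hit. (Filed by trop-lit g33, SOURCES A49; VALUE-FREE; no new-physics claim.)
-/

noncomputable section

open Matrix Finset MvPolynomial

namespace Literature.MathematicalPhysics.QuantumFieldTheory.BorinskyMunchTellander2023

open Literature.MathematicalPhysics.QuantumFieldTheory

variable {N V : ℕ} (E : Fin N → Fin (V + 1) × Fin (V + 1))

/-! ### Part 1 — the first cofactors of the grounded conductance Laplacian are separating-2-forest sums
(the case `I = (v_0, u)`, `J = (v_0, v)` of the all-minors matrix-tree theorem) -/

section Cofactors

variable {R : Type*} [CommRing R]

/-- V3a's rank-form «2-дерево» (`F.card + 1 = V ∧ rk F + 1 = V`) and the tropical seat's rank-form spanning 2-forest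
(`F.card + 1 = V ∧ rk F = F.card`) are the same predicate («2-дерево — это подграф G, содержащий все вершины G, не имеющий циклов и
имеющий ровно две компоненты связности» = Brown's spanning 2-tree). [cite: Volkov2016, §5.1 p.1174 (definition of 2-trees); Brown2017, Def. 1.2] -/
theorem isTwoTree_iff_isSpanningTwoForest (F : Finset (Fin N)) :
    Volkov2016.IsTwoTree E F ↔ IsSpanningTwoForest E F := by
  unfold Volkov2016.IsTwoTree IsSpanningTwoForest
  constructor
  · rintro ⟨h1, h2⟩
    exact ⟨h1, by omega⟩
  · rintro ⟨h1, h2⟩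
    exact ⟨h1, by omega⟩

/-- The reduced incidence row of a line from the non-root vertex `i+1` to the root `0` is the unit vector `e_i`.
[cite: Biggs1974, Ch. 4 Def. 4.2 (incidence matrix)] -/
theorem auxRow_succ_zero (i : Fin V) : Volkov2016.auxRow R i.succ 0 = Pi.single i 1 := by
  funext j
  have h0 : (0 : Fin (V + 1)) ≠ j.succ := (Fin.succ_ne_zero j).symm
  by_cases h : i = j
  · subst h
    simp [Volkov2016.auxRow, h0]
  · have h' : j ≠ i := fun h' => h h'.symm
    simp [Volkov2016.auxRow, h0, h, h', Fin.succ_inj]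

/-- The reduced incidence row of a line between the non-root vertices `i+1` and `k+1` is `e_i − e_k`.
[cite: Biggs1974, Ch. 4 Def. 4.2 (incidence matrix)] -/
theorem auxRow_succ_succ (i k : Fin V) :
    Volkov2016.auxRow R i.succ k.succ = Pi.single i 1 - Pi.single k 1 := by
  funext j
  simp only [Volkov2016.auxRow, Pi.sub_apply, Pi.single_apply, Fin.succ_inj]
  congr 1
  · exact if_congr eq_comm rfl rfl
  · exact if_congr eq_comm rfl rfl

/-- The grounded conductance Laplacian `ℰᵀ diag(g) ℰ` is symmetric. [cite: Biggs1974, Ch. 6 Thm 6.3 (the matrix Q = DDᵀ)] -/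
theorem isSymm_conductanceLaplacian (g : Fin N → R) : (Volkov2016.laplacian R E g).IsSymm :=
  Matrix.IsSymm.ext fun i k => by
    rw [Volkov2016.laplacian_apply, Volkov2016.laplacian_apply]
    exact Finset.sum_congr rfl fun e _ => by ring

/-- `e_iᵀ A e_k = A_{ik}`. [folklore] -/
private theorem single_dotProduct_mulVec_single (A : Matrix (Fin V) (Fin V) R) (i k : Fin V) :
    Pi.single i (1 : R) ⬝ᵥ (A *ᵥ Pi.single k 1) = A i k := by
  rw [mulVec_single_one, single_one_dotProduct, col_apply]

/-- `(e_i − e_k)ᵀ A (e_i − e_k) = A_{ii} + A_{kk} − A_{ik} − A_{ki}`. [folklore] -/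
private theorem sub_single_quadForm (A : Matrix (Fin V) (Fin V) R) (i k : Fin V) :
    (Pi.single i (1 : R) - Pi.single k 1) ⬝ᵥ (A *ᵥ (Pi.single i 1 - Pi.single k 1)) =
      A i i + A k k - A i k - A k i := by
  rw [mulVec_sub, sub_dotProduct, dotProduct_sub, dotProduct_sub, single_dotProduct_mulVec_single,
    single_dotProduct_mulVec_single, single_dotProduct_mulVec_single, single_dotProduct_mulVec_single]
  ring

/-- **Diagonal cofactors**: `adj(L(g))_{ii} = τ₂(g; i+1 | 0)`, the conductance-weighted sum over the 2-trees separating the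
vertex `i+1` from the root — V3a's `uᵀ adj(L) u = τ₂` at the line `(i+1, 0)`, whose row is `e_i`.
[cite: BognerWeinzierl2010, §3 eq. (the all-minors matrix-tree theorem, case I = J) (arXiv p.11)] -/
theorem adjugate_laplacian_apply_self [Nontrivial R] (g : Fin N → R) (i : Fin V) :
    (Volkov2016.laplacian R E g).adjugate i i = Volkov2016.sepTwoTreeSum R E i.succ 0 g := by
  have h := Volkov2016.auxRow_dotProduct_adjugate_laplacian E i.succ 0 g
  rwa [auxRow_succ_zero, single_dotProduct_mulVec_single] at h

/-- **Polarisation**: `2·adj(L(g))_{ik} = τ₂(g; i+1 | 0) + τ₂(g; k+1 | 0) − τ₂(g; i+1 | k+1)` — the three diagonal values of the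
quadratic form `u ↦ uᵀ adj(L) u` at the rows `e_i`, `e_k`, `e_i − e_k` of the lines `(i+1,0)`, `(k+1,0)`, `(i+1,k+1)`, and the symmetry
of `adj(L)`. [cite: BognerWeinzierl2010, §3 (all-minors matrix-tree theorem) (arXiv p.11); HornJohnson2013, (0.8.5.11)] -/
theorem two_mul_adjugate_laplacian_apply [Nontrivial R] (g : Fin N → R) (i k : Fin V) :
    2 * (Volkov2016.laplacian R E g).adjugate i k =
      Volkov2016.sepTwoTreeSum R E i.succ 0 g + Volkov2016.sepTwoTreeSum R E k.succ 0 g -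
        Volkov2016.sepTwoTreeSum R E i.succ k.succ g := by
  have hi := adjugate_laplacian_apply_self E g i
  have hk := adjugate_laplacian_apply_self E g k
  have hik := Volkov2016.auxRow_dotProduct_adjugate_laplacian E i.succ k.succ g
  rw [auxRow_succ_succ, sub_single_quadForm] at hik
  have hsymm : (Volkov2016.laplacian R E g).adjugate k i = (Volkov2016.laplacian R E g).adjugate i k :=
    (isSymm_conductanceLaplacian E g).adjugate.apply i k
  linear_combination hi + hk - hik - hsymm

open scoped Classical in
/-- In a spanning 2-forest the indicator bookkeeping `[i+1 ∤ 0] + [k+1 ∤ 0] − [i+1 ∤ k+1] = 2·[i+1 ∤ 0 ∧ k+1 ∤ 0]`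
(`∤` = "not joined"): both marked vertices lie in the non-root tree iff each is cut from the root, and then they are joined.
[cite: Brown2017, Def. 1.2 (spanning 2-trees have exactly two components)] -/
private theorem twoForest_indicator_identity {F : Finset (Fin N)} (hF : IsSpanningTwoForest E F) (i k : Fin V)
    (c : R) :
    (if ¬ (edgeGraph E F).Reachable i.succ 0 then c else 0) +
        (if ¬ (edgeGraph E F).Reachable k.succ 0 then c else 0) -
        (if ¬ (edgeGraph E F).Reachable i.succ k.succ then c else 0) =
      2 * (if ¬ (edgeGraph E F).Reachable 0 i.succ ∧ ¬ (edgeGraph E F).Reachable 0 k.succ then c else 0) := by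
  by_cases ha : (edgeGraph E F).Reachable 0 i.succ <;> by_cases hb : (edgeGraph E F).Reachable 0 k.succ
  · have hik : (edgeGraph E F).Reachable i.succ k.succ := ha.symm.trans hb
    simp [ha, hb, ha.symm, hb.symm, hik]
  · have hik : ¬ (edgeGraph E F).Reachable i.succ k.succ := fun h => hb (ha.trans h)
    have hb' : ¬ (edgeGraph E F).Reachable k.succ 0 := fun h => hb h.symm
    simp [ha, hb, ha.symm, hb', hik]
  · have hik : ¬ (edgeGraph E F).Reachable i.succ k.succ := fun h => ha (hb.trans h.symm)
    have ha' : ¬ (edgeGraph E F).Reachable i.succ 0 := fun h => ha h.symm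
    simp [ha, hb, ha', hb.symm, hik]
  · have hik : (edgeGraph E F).Reachable i.succ k.succ := by
      by_contra h
      exact hb ((hF.reachable_iff_not_reachable ha k.succ).2 h)
    have ha' : ¬ (edgeGraph E F).Reachable i.succ 0 := fun h => ha h.symm
    have hb' : ¬ (edgeGraph E F).Reachable k.succ 0 := fun h => hb h.symm
    simp [ha, hb, ha', hb', hik, two_mul]

open scoped Classical in
/-- V3a's separating-2-tree sum as an indicator sum over all spanning 2-forests. [cite: Grimmett2018, Ch. 1 proof of Thm 1.16 (p. 92, s/t bushes)] -/
theorem sepTwoTreeSum_eq_sum_ite (a b : Fin (V + 1)) (g : Fin N → R) :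
    Volkov2016.sepTwoTreeSum R E a b g =
      ∑ F ∈ univ.filter (IsSpanningTwoForest E),
        if ¬ (edgeGraph E F).Reachable a b then ∏ e ∈ F, g e else 0 := by
  rw [Volkov2016.sepTwoTreeSum, ← Finset.sum_filter]
  congr 1
  ext F
  simp only [Finset.mem_filter, Finset.mem_univ, true_and, Volkov2016.IsSepTwoTree,
    isTwoTree_iff_isSpanningTwoForest]

open scoped Classical in
/-- `2·adj(L(g))_{ik} = 2·Σ_{F : i+1, k+1 both cut from the root} Π_{e∈F} g_e` over any nontrivial commutative ring.
[cite: BognerWeinzierl2010, §3 (all-minors matrix-tree theorem) (arXiv p.11)] -/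
theorem two_mul_adjugate_laplacian_eq [Nontrivial R] (g : Fin N → R) (i k : Fin V) :
    2 * (Volkov2016.laplacian R E g).adjugate i k =
      2 * ∑ F ∈ univ.filter (IsSpanningTwoForest E),
        if ¬ (edgeGraph E F).Reachable 0 i.succ ∧ ¬ (edgeGraph E F).Reachable 0 k.succ then ∏ e ∈ F, g e else 0 := by
  rw [two_mul_adjugate_laplacian_apply, sepTwoTreeSum_eq_sum_ite, sepTwoTreeSum_eq_sum_ite,
    sepTwoTreeSum_eq_sum_ite, ← Finset.sum_add_distrib, ← Finset.sum_sub_distrib, Finset.mul_sum]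
  refine Finset.sum_congr rfl fun F hF => ?_
  exact twoForest_indicator_identity E (Finset.mem_filter.1 hF).2 i k _

open scoped Classical in
/-- **THE FIRST COFACTORS OF THE GROUNDED LAPLACIAN (all-minors matrix-tree theorem, `I = (v_0, u)`, `J = (v_0, v)`)**:
`adj(ℰᵀ diag(g) ℰ)_{ik} = Σ_F Π_{e∈F} g_e` over the spanning 2-forests `F` whose root tree contains neither `i+1` nor `k+1`
(i.e. one tree contains `v_0`, the other both marked vertices; sign `+`), for EVERY commutative ring — proved in `ℤ[g_e]`, where
`2` is cancellable, and transported along `ℤ[g] → R`. [cite: BognerWeinzierl2010, §3 (all-minors matrix-tree theorem, after [Chaiken 1982]) (arXiv p.11)] -/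
theorem adjugate_laplacian_apply (g : Fin N → R) (i k : Fin V) :
    (Volkov2016.laplacian R E g).adjugate i k =
      ∑ F ∈ univ.filter (IsSpanningTwoForest E),
        if ¬ (edgeGraph E F).Reachable 0 i.succ ∧ ¬ (edgeGraph E F).Reachable 0 k.succ then ∏ e ∈ F, g e else 0 := by
  -- the universal case `R = ℤ[X_e]`, `g = X`
  have huniv : (Volkov2016.laplacian (MvPolynomial (Fin N) ℤ) E X).adjugate i k =
      ∑ F ∈ univ.filter (IsSpanningTwoForest E),
        if ¬ (edgeGraph E F).Reachable 0 i.succ ∧ ¬ (edgeGraph E F).Reachable 0 k.succ then ∏ e ∈ F, X e else 0 :=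
    mul_left_cancel₀ two_ne_zero (two_mul_adjugate_laplacian_eq E X i k)
  -- transport along `φ = eval at g`
  set φ : MvPolynomial (Fin N) ℤ →+* R := MvPolynomial.eval₂Hom (Int.castRingHom R) g with hφ
  have hX : ∀ e, φ (X e) = g e := fun e => by simp [hφ]
  have hL : φ.mapMatrix (Volkov2016.laplacian (MvPolynomial (Fin N) ℤ) E X) = Volkov2016.laplacian R E g := by
    ext a b
    simp only [RingHom.mapMatrix_apply, Matrix.map_apply, Volkov2016.laplacian_apply, map_sum, map_mul,
      reducedIncidence_apply, map_sub, apply_ite φ, map_one, map_zero, hX]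
  have h1 := congr_arg φ huniv
  rw [show φ ((Volkov2016.laplacian _ E X).adjugate i k) =
      (φ.mapMatrix (Volkov2016.laplacian _ E X).adjugate) i k from rfl, RingHom.map_adjugate, hL] at h1
  rw [h1, map_sum]
  refine Finset.sum_congr rfl fun F _ => ?_
  rw [apply_ite φ, map_prod, map_zero]
  simp only [hX]

end Cofactors

/-! ### Part 2 — Borinsky–Munch–Tellander (eq:laplaceUF), SECOND identity / Borinsky (PsiPhi_fast), SECOND identity -/

section LaplaceUF

variable {K : Type*} [Field K]

/-- BMT23's `𝓛(x) = ℰᵀ diag(1/x) ℰ` is the conductance Laplacian at `g_e = 1/x_e`. [cite: BorinskyMunchTellander2023, §2.1 (main.tex l.291–296)] -/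
theorem laplacian_eq_conductanceLaplacian (x : Fin N → K) :
    laplacian E x = Volkov2016.laplacian K E (fun e => (x e)⁻¹) := by
  rw [laplacian, Volkov2016.laplacian, Matrix.mul_assoc]

open scoped Classical in
/-- `(Π_e x_e)·adj(𝓛(x))_{ik} = Σ_{F : i+1, k+1 off the root tree} Π_{e∉F} x_e` for non-zero edge weights.
[cite: BorinskyMunchTellander2023, §2.1 eq. (laplaceUF) with eq. (polyUF) (main.tex l.297–305)] -/
theorem prod_mul_adjugate_laplacian_apply (x : Fin N → K) (hx : ∀ e, x e ≠ 0) (i k : Fin V) :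
    (∏ e, x e) * (laplacian E x).adjugate i k =
      ∑ F ∈ univ.filter (IsSpanningTwoForest E),
        if ¬ (edgeGraph E F).Reachable 0 i.succ ∧ ¬ (edgeGraph E F).Reachable 0 k.succ then ∏ e ∈ Fᶜ, x e else 0 := by
  rw [laplacian_eq_conductanceLaplacian, adjugate_laplacian_apply, Finset.mul_sum]
  refine Finset.sum_congr rfl fun F _ => ?_
  rw [mul_ite, mul_zero]
  congr 1
  rw [← Finset.prod_mul_prod_compl F x, Finset.prod_inv_distrib, mul_right_comm,
    mul_inv_cancel₀ (Finset.prod_ne_zero_iff.2 fun e _ => hx e), one_mul]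

open scoped Classical in
/-- **`𝒰(x)·𝓛⁻¹(x)_{u,v}` is a two-forest polynomial**: `𝒰(x)·𝓛(x)⁻¹_{ik} = Σ_F Π_{e∉F} x_e` over the spanning 2-forests whose
root tree `∋ v_0` contains neither `u = i+1` nor `v = k+1` — the entrywise content of (eq:laplaceUF)'s second identity, valid
wherever `x_e ≠ 0` and `det 𝓛(x) ≠ 0` (any field, so also at complex deformed points).
[cite: BorinskyMunchTellander2023, §2.1 eq. (laplaceUF) (main.tex l.297–300); Borinsky2020, §7.1 eq. (PsiPhi_fast) (tropical.tex l.1190)] -/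
theorem kirchhoffEval_mul_inv_laplacian_apply (x : Fin N → K) (hx : ∀ e, x e ≠ 0)
    (hdet : (laplacian E x).det ≠ 0) (i k : Fin V) :
    kirchhoffEval E x * (laplacian E x)⁻¹ i k =
      ∑ F ∈ univ.filter (IsSpanningTwoForest E),
        if ¬ (edgeGraph E F).Reachable 0 i.succ ∧ ¬ (edgeGraph E F).Reachable 0 k.succ then ∏ e ∈ Fᶜ, x e else 0 := by
  rw [← prod_mul_adjugate_laplacian_apply E x hx, kirchhoffEval_eq_det_laplacian_mul_prod E x hx,
    Matrix.inv_def, Ring.inverse_eq_inv, Matrix.smul_apply, smul_eq_mul]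
  calc (laplacian E x).det * (∏ e, x e) * (((laplacian E x).det)⁻¹ * (laplacian E x).adjugate i k)
      = (laplacian E x).det * ((laplacian E x).det)⁻¹ * ((∏ e, x e) * (laplacian E x).adjugate i k) := by ring
    _ = (∏ e, x e) * (laplacian E x).adjugate i k := by rw [mul_inv_cancel₀ hdet, one_mul]

open scoped Classical in
/-- **`𝒰(x)·Σ_{u,v} Q^{u,v} 𝓛⁻¹(x)_{u,v} = Σ_F Q(F) Π_{e∉F} x_e`** with `Q(F) = Σ Q^{u,v}` over the pairs of non-root vertices in
the non-root tree of `F` — for ANY coefficient array `Q` on the non-root vertices (no symmetry, no momentum conservation, any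
field). [cite: BorinskyMunchTellander2023, §2.1 eq. (laplaceUF) (main.tex l.297–300); Borinsky2020, §7.1 eq. (PsiPhi_fast) (tropical.tex l.1190)] -/
theorem kirchhoffEval_mul_sum_mul_inv_laplacian (x : Fin N → K) (hx : ∀ e, x e ≠ 0)
    (hdet : (laplacian E x).det ≠ 0) (Q : Fin V → Fin V → K) :
    kirchhoffEval E x * ∑ i, ∑ k, Q i k * (laplacian E x)⁻¹ i k =
      ∑ F ∈ univ.filter (IsSpanningTwoForest E),
        (∑ i, ∑ k, if ¬ (edgeGraph E F).Reachable 0 i.succ ∧ ¬ (edgeGraph E F).Reachable 0 k.succ then Q i k else 0) *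
          ∏ e ∈ Fᶜ, x e := by
  have h : ∀ i k, kirchhoffEval E x * (Q i k * (laplacian E x)⁻¹ i k) =
      ∑ F ∈ univ.filter (IsSpanningTwoForest E),
        (if ¬ (edgeGraph E F).Reachable 0 i.succ ∧ ¬ (edgeGraph E F).Reachable 0 k.succ then Q i k else 0) *
          ∏ e ∈ Fᶜ, x e := fun i k => by
    rw [mul_left_comm, kirchhoffEval_mul_inv_laplacian_apply E x hx hdet, Finset.mul_sum]
    refine Finset.sum_congr rfl fun F _ => ?_
    rw [mul_ite, ite_mul, mul_zero, zero_mul]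
  simp_rw [Finset.mul_sum, h]
  refine (Finset.sum_congr rfl fun i _ => Finset.sum_comm).trans ?_
  rw [Finset.sum_comm]
  refine Finset.sum_congr rfl fun F _ => ?_
  rw [Finset.sum_mul]
  exact Finset.sum_congr rfl fun i _ => by rw [Finset.sum_mul]

open scoped Classical in
/-- A sum over the complement of the root side runs over the NON-ROOT vertices cut from the root (the root is on its own side).
[cite: Borinsky2020, §7.1 after eq. (PsiPhi_fast) ("no information is lost when only V−1 of the V incoming momenta are used", tropical.tex l.1191)] -/
private theorem sum_compl_rootSide_eq {β : Type*} [AddCommMonoid β] (F : Finset (Fin N)) (f : Fin (V + 1) → β) :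
    ∑ u ∈ (rootSide E F)ᶜ, f u = ∑ i : Fin V, if ¬ (edgeGraph E F).Reachable 0 i.succ then f i.succ else 0 := by
  have hc : (rootSide E F)ᶜ = univ.filter (fun u => ¬ (edgeGraph E F).Reachable 0 u) := by
    ext u
    simp [rootSide]
  rw [hc, Finset.sum_filter, Fin.sum_univ_succ, if_neg (not_not.2 (SimpleGraph.Reachable.refl _)), zero_add]

open scoped Classical in
/-- **`p(F)²` read off `𝒫` on the NON-ROOT side**: under momentum conservation the squared momentum of the root tree equals that
of the other tree (`sqMomentum_compl`), which involves only the `|V|−1` non-root vertices `u, v ∈ V∖{v_0}` of (eq:laplaceUF).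
[cite: BorinskyMunchTellander2023, §2.1–2.2 (main.tex l.297–300, l.329–332)] -/
theorem sqMomentum_rootSide_eq_sum_succ {P : Matrix (Fin (V + 1)) (Fin (V + 1)) ℝ} (hP : P.IsSymm)
    (hcons : ∀ u, ∑ v, P u v = 0) (F : Finset (Fin N)) :
    sqMomentum P (rootSide E F) =
      ∑ i : Fin V, ∑ k : Fin V,
        if ¬ (edgeGraph E F).Reachable 0 i.succ ∧ ¬ (edgeGraph E F).Reachable 0 k.succ then P i.succ k.succ else 0 := by
  rw [← sqMomentum_compl hP hcons (rootSide E F), sqMomentum, sum_compl_rootSide_eq]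
  refine Finset.sum_congr rfl fun i _ => ?_
  rw [sum_compl_rootSide_eq]
  by_cases hi : (edgeGraph E F).Reachable 0 i.succ
  · rw [if_neg (not_not.2 hi)]
    symm
    exact Finset.sum_eq_zero fun k _ => if_neg (fun h => h.1 hi)
  · rw [if_pos hi]
    refine Finset.sum_congr rfl fun k _ => ?_
    by_cases hk : (edgeGraph E F).Reachable 0 k.succ
    · rw [if_neg (not_not.2 hk), if_neg (fun h => h.2 hk)]
    · rw [if_pos hk, if_pos ⟨hi, hk⟩]

open scoped Classical in
/-- **BMT23 (eq:laplaceUF), SECOND IDENTITY, AS PRINTED: `ℱ(x) = 𝒰(x)·(−Σ_{u,v∈V∖{v_0}} 𝒫^{u,v} 𝓛⁻¹(x)_{u,v} + Σ_e m_e² x_e)`**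
— for the polynomial `ℱ` of eq. (polyUF) read off a symmetric kinematic matrix `𝒫` with vanishing row sums (the tree's
`gramSecondSymanzik E 𝒫 m`), real edge weights with `x_e ≠ 0` and `det 𝓛(x) ≠ 0` (e.g. `x > 0` on a connected graph,
`eval_gramSecondSymanzik_eq_laplaceUF_of_pos`); `u = i+1`, `v = k+1` run over the non-root vertices `Fin V ≃ V∖{v_0}`.
[cite: BorinskyMunchTellander2023, §2.1 eq. (laplaceUF) (main.tex l.297–300)] -/
theorem eval_gramSecondSymanzik_eq_laplaceUF {P : Matrix (Fin (V + 1)) (Fin (V + 1)) ℝ} (hP : P.IsSymm)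
    (hcons : ∀ u, ∑ v, P u v = 0) (m : Fin N → ℝ) {x : Fin N → ℝ} (hx : ∀ e, x e ≠ 0)
    (hdet : (laplacian E x).det ≠ 0) :
    MvPolynomial.eval x (gramSecondSymanzik E P m) =
      kirchhoffEval E x *
        (-(∑ i : Fin V, ∑ k : Fin V, P i.succ k.succ * (laplacian E x)⁻¹ i k) + ∑ e, m e ^ 2 * x e) := by
  rw [mul_add, mul_neg, kirchhoffEval_mul_sum_mul_inv_laplacian E x hx hdet (fun i k => P i.succ k.succ),
    gramSecondSymanzik, twoForestPolynomial, map_add, map_sum, map_mul, map_sum, eval_kirchhoffPolynomial]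
  congr 1
  · rw [← Finset.sum_neg_distrib]
    refine Finset.sum_congr rfl fun F _ => ?_
    rw [MvPolynomial.smul_eval, map_prod, sqMomentum_rootSide_eq_sum_succ E hP hcons F, neg_mul]
    simp only [MvPolynomial.eval_X]
  · congr 1
    refine Finset.sum_congr rfl fun e _ => ?_
    rw [MvPolynomial.smul_eval, MvPolynomial.eval_X]

open scoped Classical in
/-- The same at positive edge weights on a connected graph (where `det 𝓛(x) > 0`, `GraphLaplacian.det_laplacian_pos`) — the Euclidean /
pseudo-Euclidean evaluation point of §4.2 step 9 with `λ = 0`. [cite: BorinskyMunchTellander2023, §2.1 eq. (laplaceUF); §4.2 steps 1–2, 9 (main.tex l.1079–1099)] -/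
theorem eval_gramSecondSymanzik_eq_laplaceUF_of_pos (hconn : IsConnectedEdgeList E)
    {P : Matrix (Fin (V + 1)) (Fin (V + 1)) ℝ} (hP : P.IsSymm) (hcons : ∀ u, ∑ v, P u v = 0) (m : Fin N → ℝ)
    {x : Fin N → ℝ} (hx : ∀ e, 0 < x e) :
    MvPolynomial.eval x (gramSecondSymanzik E P m) =
      kirchhoffEval E x *
        (-(∑ i : Fin V, ∑ k : Fin V, P i.succ k.succ * (laplacian E x)⁻¹ i k) + ∑ e, m e ^ 2 * x e) :=
  eval_gramSecondSymanzik_eq_laplaceUF E hP hcons m (fun e => (hx e).ne') (det_laplacian_pos E hconn x hx).ne'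

open scoped Classical in
/-- **`𝒱(x) = ℱ(x)/𝒰(x) = −Σ_{u,v} 𝒫^{u,v} 𝓛⁻¹(x)_{u,v} + Σ_e m_e² x_e`** — the quotient §2.3/§4.2 actually evaluate ("Compute the
inverse 𝓛⁻¹(x) … to obtain values for 𝒰, ℱ and 𝒱 = ℱ/𝒰"). [cite: BorinskyMunchTellander2023, §2.1 (main.tex l.291–300); §4.2 steps 2, 9 (main.tex l.1081–1099)] -/
theorem eval_gramSecondSymanzik_div_kirchhoffEval {P : Matrix (Fin (V + 1)) (Fin (V + 1)) ℝ} (hP : P.IsSymm)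
    (hcons : ∀ u, ∑ v, P u v = 0) (m : Fin N → ℝ) {x : Fin N → ℝ} (hx : ∀ e, x e ≠ 0)
    (hdet : (laplacian E x).det ≠ 0) :
    MvPolynomial.eval x (gramSecondSymanzik E P m) / kirchhoffEval E x =
      -(∑ i : Fin V, ∑ k : Fin V, P i.succ k.succ * (laplacian E x)⁻¹ i k) + ∑ e, m e ^ 2 * x e := by
  have hU : kirchhoffEval E x ≠ 0 := by
    rw [kirchhoffEval_eq_det_laplacian_mul_prod E x hx]
    exact mul_ne_zero hdet (Finset.prod_ne_zero_iff.2 fun e _ => hx e)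
  rw [eval_gramSecondSymanzik_eq_laplaceUF E hP hcons m hx hdet, mul_div_cancel_left₀ _ hU]

open scoped Classical in
/-- **Borinsky 2020 (PsiPhi_fast), SECOND IDENTITY: `Φ_G(x) = Ψ_G·(Tr(Pᵀ L̃⁻¹ P) + Σ_e x_e m_e²)`** with
`Tr(Pᵀ L̃⁻¹ P) = Σ_{v,w=1}^{V−1} L̃⁻¹_{vw} ⟨p^{(v)}, p^{(w)}⟩` for Euclidean vector momenta `p^{(v)}` in a real inner-product space
under momentum conservation — the tree's `secondSymanzikPolynomial E p m` (eq. (PsiPhi_slow)); equivalently BMT23's identity at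
`𝒫 = −(⟨p̃_u, p̃_v⟩)`. [cite: Borinsky2020, §7.1 eq. (PsiPhi_fast) (tropical.tex l.1190–1191); BorinskyMunchTellander2023, §2.1 eq. (laplaceUF), §2.2 (main.tex l.336–341)] -/
theorem eval_secondSymanzikPolynomial_eq_laplaceUF {W : Type*} [NormedAddCommGroup W] [InnerProductSpace ℝ W]
    (p : Fin (V + 1) → W) (hcons : ∑ v, p v = 0) (m : Fin N → ℝ) {x : Fin N → ℝ} (hx : ∀ e, x e ≠ 0)
    (hdet : (laplacian E x).det ≠ 0) :
    MvPolynomial.eval x (secondSymanzikPolynomial E p m) =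
      kirchhoffEval E x *
        ((∑ i : Fin V, ∑ k : Fin V, inner ℝ (p i.succ) (p k.succ) * (laplacian E x)⁻¹ i k) + ∑ e, m e ^ 2 * x e) := by
  rw [← gramSecondSymanzik_allMinusGram, eval_gramSecondSymanzik_eq_laplaceUF E (isSymm_allMinusGram p)
    (sum_allMinusGram hcons) m hx hdet]
  simp only [allMinusGram_apply, neg_mul, Finset.sum_neg_distrib, neg_neg]

open scoped Classical in
/-- The same at positive edge weights on a connected graph ("the reduced Laplacian … is positive definite").
[cite: Borinsky2020, §7.1 eq. (PsiPhi_fast) (tropical.tex l.1189–1191)] -/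
theorem eval_secondSymanzikPolynomial_eq_laplaceUF_of_pos (hconn : IsConnectedEdgeList E)
    {W : Type*} [NormedAddCommGroup W] [InnerProductSpace ℝ W]
    (p : Fin (V + 1) → W) (hcons : ∑ v, p v = 0) (m : Fin N → ℝ) {x : Fin N → ℝ} (hx : ∀ e, 0 < x e) :
    MvPolynomial.eval x (secondSymanzikPolynomial E p m) =
      kirchhoffEval E x *
        ((∑ i : Fin V, ∑ k : Fin V, inner ℝ (p i.succ) (p k.succ) * (laplacian E x)⁻¹ i k) + ∑ e, m e ^ 2 * x e) :=
  eval_secondSymanzikPolynomial_eq_laplaceUF E p hcons m (fun e => (hx e).ne') (det_laplacian_pos E hconn x hx).ne'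

/-- `Tr(Pᵀ M P) = Σ_{v,w} (Σ_μ P_{vμ} P_{wμ})·M_{vw}` — the trace of Borinsky's (PsiPhi_fast) written out entrywise ("P_{v,μ} = p^{(v)}_μ where
v = 1,…,V−1 and μ is a D-dimensional spacetime index"). [cite: Borinsky2020, §7.1 eq. (PsiPhi_fast) (tropical.tex l.1190–1191)] -/
theorem trace_transpose_mul_mul {ι : Type*} [Fintype ι] (M : Matrix (Fin V) (Fin V) K) (Pm : Matrix (Fin V) ι K) :
    Matrix.trace (Pmᵀ * M * Pm) = ∑ i, ∑ k, (∑ μ, Pm i μ * Pm k μ) * M i k := by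
  simp only [Matrix.trace, Matrix.diag, Matrix.mul_apply, Matrix.transpose_apply, Finset.sum_mul]
  rw [Finset.sum_comm]
  refine (Finset.sum_congr rfl fun b _ => Finset.sum_comm).trans ?_
  rw [Finset.sum_comm]
  refine Finset.sum_congr rfl fun a _ => Finset.sum_congr rfl fun b _ => Finset.sum_congr rfl fun μ _ => ?_
  ring

/-- The Euclidean scalar product of `ℝ^D` in coordinates. [folklore] -/
private theorem inner_euclideanSpace_eq_sum {ι : Type*} [Fintype ι] (a b : EuclideanSpace ℝ ι) :
    inner ℝ a b = ∑ μ, a μ * b μ := by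
  rw [PiLp.inner_apply]
  refine Finset.sum_congr rfl fun μ _ => ?_
  simp [mul_comm]

open scoped Classical in
/-- **Borinsky 2020 (PsiPhi_fast), SECOND IDENTITY, LITERALLY: `Φ_G(x) = Ψ_G(x)·(Tr(Pᵀ L̃⁻¹ P) + Σ_e x_e m_e²)`, "where P is the
(V−1) × D matrix, given row-wise by the incoming momenta, p^{(v)} ∈ ℝ^D: P_{v,μ} = p^{(v)}_μ where v = 1,…,V−1 … Note that due to
momentum conservation no information is lost when only V−1 of the V incoming momenta are used"** — momenta in `ℝ^D = EuclideanSpace ℝ ι`,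
the root vertex `0` being the dropped one, `L̃ = 𝓛(x)`. [cite: Borinsky2020, §7.1 eq. (PsiPhi_fast) (tropical.tex l.1190–1191)] -/
theorem eval_secondSymanzikPolynomial_eq_trace {ι : Type*} [Fintype ι] (p : Fin (V + 1) → EuclideanSpace ℝ ι)
    (hcons : ∑ v, p v = 0) (m : Fin N → ℝ) {x : Fin N → ℝ} (hx : ∀ e, x e ≠ 0) (hdet : (laplacian E x).det ≠ 0) :
    MvPolynomial.eval x (secondSymanzikPolynomial E p m) =
      kirchhoffEval E x *
        (Matrix.trace ((Matrix.of fun (v : Fin V) (μ : ι) => p v.succ μ)ᵀ * (laplacian E x)⁻¹ *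
            Matrix.of fun (v : Fin V) (μ : ι) => p v.succ μ) + ∑ e, m e ^ 2 * x e) := by
  rw [eval_secondSymanzikPolynomial_eq_laplaceUF E p hcons m hx hdet, trace_transpose_mul_mul]
  congr 3
  funext i
  refine Finset.sum_congr rfl fun k _ => ?_
  rw [inner_euclideanSpace_eq_sum]
  rfl

end LaplaceUF

end Literature.MathematicalPhysics.QuantumFieldTheory.BorinskyMunchTellander2023

end
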